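import Summits.QuantumFields.BalabanUV.T4Continuum.Support.OutputRateResidual
import Literature.MathematicalPhysics.QuantumFieldTheory.Balaban1983to89.T4InputCauchyRateSpecies

/-!
# OutputRateArithmetic — the two ARITHMETIC leaves of the NE5 skeleton (route P1): L10 (REACH: the scale `k₀` and the
# first-scales constant `B`) and L11 (SMALLNESS: the rate window), discharged to STRICT INEQUALITIES among the model constants;
# the exact admissible region of the census currencies; kernel certificates for the census exponent column
# (cell `pub-balaban`, T⁴-continuum fan-out, row NE5 of `HOME/BINDER-OWNERS.md`; NE5 formalisation swarm, claim-table row O6-n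
# NUMERICS of `t4/b2b-balaban-t4-ne5-p1/O1-CLAIM-TABLE-NE5-P1.md`; unit `b2b-balaban-t4-ne5-formalise-leaf-10`; LEAN PLACEMENT
# RULE 2026-08-19: our bookkeeping lives under `Summits/`, nothing here is a published statement)

HONEST FRAMING (T4-DAG PAGE 1).  The cell's T⁴ target is rung (B)+1: existence AND uniqueness of the ε → 0 limit of Bałaban's
unit-scale gauge-invariant expectations on a FIXED finite torus T⁴ — NOT infinite volume, NOT a mass gap, NOT the Clay problem.
The spine estimate NE5 (`T4OutputRate.NE5`) is NOT PRINTED in the audited series (cell GAPS G-t4-U3-1) and is NOT PROVED here: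
this module is real arithmetic about the binders of the LANDED composition (`T4InputCauchyRateData.StepModel.
ne5_at_of_stepModel_lip_nat` and its species twin `T4InputCauchyRateSpecies.ne5_at_of_stepModel_lip₂_nat`), over an ABSTRACT
`StepModel`.  Nothing printed is asserted; 0 cite tags; no «…» quotation is introduced.  Spine estimates PROVED: 0/9, unchanged;
leaves instantiated on Bałaban's objects: 0/12, unchanged.  HONEST DEPENDENCY (cell, verbatim): continuum YM on T⁴ ⇐ BetaPertH ∧
nine spine estimates (0/9 proved); BetaPertH ⇐ (D1) ∧ (D4) ∧ CAP+tail; G-an2-4 gates asym, D1 and NE2/3/4.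

WHAT THE TWO LEAVES ARE (skeleton `t4/b2b-balaban-t4-ne5-p1/SKELETON-NE5-P1.md` §3).  Every END face of the route carries
L10 = `hnear : D·θ^{k₀} + c(EA₀ + E₀)/(1 − ω) ≤ ρ₀`, `hB : 0 ≤ B`, `hfirst : ∀ k < k₀, EA₀ + E₀ ≤ B·θ^k` (`D ≥ 0` the face's
input-rate constant: `δ + δ′`, `c₁/r₀ + δ′`, …) and L11 = `hsmall : ω + Λ·c < θ′` (`θ ≤ θ′ ≤ 1`), booked NUMERIC ("satisfiable by
a choice of k₀ iff c(EA₀ + E₀)/(1 − ω) < ρ₀"; "decides the RATE θ′, not the estimate").  IN PRINT every letter entering them is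
O(1)-SYMBOLIC (census sheet `t4/b2b-balaban-t4-ne5-formalise-leaf-10/B13SmallnessCensus.md`: letter, locus, status; the only
printed NUMERIC data touching them are «L is an odd, positive integer > 11» of [Balaban1987RG1] p. 251 and the CEILING ν ≤ ½ on
the new-term ratio of [Balaban1988RG2Cluster] p. 21, both quoted in the imported leaves, not here), so NO numeric instance on
Bałaban's constants is claimed.  Kernel content: (§1–§2) the two leaves discharged EXACTLY to strict inequalities; (§3) the END
faces with L10 discharged; (§4) the exact admissible REGION of the census currencies (g′)/(g″) (record `t4/T4-EST-NE5-P1.md`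
§25.3/§27.3) and NUMBERS (d) (Data leaf docstring); (§5) a certificate format for the census EXPONENT column, the lineage's
ILLUSTRATIVE rows re-certified (two external engines agree with the kernel: `kit` jobs cited in the census sheet).

## What is PROVED (kernel; Mathlib + the two imports; no `sorry`, no new axiom)

§1 (L10) `reach_scale_exists` (`0 ≤ D`, `θ < 1`, `h < ρ₀` ⟹ `∃ k₀, D·θ^{k₀} + h ≤ ρ₀`), `reach_scale_mono`, `reach_necessary`
(`D, θ > 0`: the binder forces `h < ρ₀`), `reach_scale_iff` (`(∃ k₀, hnear) ↔ h < ρ₀` — the skeleton's "iff" in the kernel),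
`reach_binders_exists` (`0 ≤ D`, `0 < θ < 1`, `c(EA₀ + E₀)/(1 − ω) < ρ₀` ⟹ `∃ k₀ B, 0 ≤ B ∧ hnear ∧ hfirst`, with
`OutputRateResidual.first_scales_const` BY NAME) — ONE `obtain` discharges the L10 binders of ANY END face of the route.
§2 (L11) `rate_window_iff`: `(∃ θ′, θ ≤ θ′ ∧ θ′ < 1 ∧ s < θ′) ↔ (θ < 1 ∧ s < 1)`; sharpness of the threshold `s = ω + Λ·c` is
`T4InputCauchyRateSharp.sharp_ne5_iff` (cited BY NAME, not re-proved).
§3 `exists_ne5_at_of_stepModel_lip_nat_reach` / `exists_ne5_at_of_stepModel_lip₂_nat_reach`: the Data / Species END faces with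
(k₀, B, hnear, hB, hfirst) REPLACED by `0 < θ < 1` and the strict reach; conclusion `∃ C₅, NE5 EA EB W κ θ′ C₅` at every
prescribed `θ′` (the constant is lost to the ∃ with `k₀`); `exists_rate_ne5_of_stepModel_lip_nat_reach`: L11 replaced by the
room `ω + Λ·c < 1` as well ⟹ `∃ θ′ < 1, ∃ C₅, NE5 …`.
§4 `gain_div_mono`, `gain_at_min_reach`; `reach_smallness_at_iff` (`ω < 1`, `0 ≤ g, y`):
`(∃ ρ₀, 2y/(1 − ω) ≤ ρ₀ ∧ ρ₀ < 1 ∧ ω + g·y/(1 − ρ₀) < t) ↔ (2y < 1 − ω ∧ ω + g·y·(1 − ω)/(1 − ω − 2y) < t)` — the minimal reach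
is optimal, the census SMALLNESS VALUE is `s⋆ = ω + g·y·(1 − ω)/(1 − ω − 2y)`; `reach_smallness_iff` (`t = 1`):
`↔ (g + 2)·y < 1 − ω` — the EXACT region: (g′) `g = γ₀`, `y = ν/d` ("admissible iff ν/d < 5/16", §25.3); (g″) `y = λν/(λ − μ)`
(§27.3); NUMBERS (d) `g = λ`, `y = ν/(λ − 1)`: at the printed ceiling ν = ½, `λ > (4 − 2ω)/(1 − 2ω)` (`lambda_threshold_iff`;
= 31/7 at ω = 1/16 — the docstring's "λ ≳ 5" made exact).
§5 `ratio_lt_rpow_neg` / `rpow_neg_lt_ratio`: `p^n·L^m < q^n ⟹ p/q < L^{−m/n}`, `q^n < p^n·L^m ⟹ L^{−m/n} < p/q` (ℕ data) — the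
certificate format of the exponent column (θ′ = L^{−a}); `example`s: illustrative rows at L = 16 (values by `norm_num`,
exponents by `decide`), thresholds 5/16, 31/7 and their L = 13 twins 4/13, 50/11 (13 = the least side length of the printed
form), and the three (g′) rows whose nearest-rounded exponent digit EXCEEDS the supremum (certified from both sides; INFO only).

NOT COVERED.  No letter of Bałaban's is given a value; instantiating `c`, `Λ`, `ω`, `δ`, `δ′`, `EA₀`, `E₀`, `ρ₀` on B13's objects
is rows O1–O5 of the claim table (0/12 today).  Provenance: NE5 swarm seat leaf-10, 2026-08-20; census sheet and engine jobs in
`HOME/t4/b2b-balaban-t4-ne5-formalise-leaf-10/`.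
-/

noncomputable section

namespace Summit.QuantumFields.BalabanUV.T4Continuum.OutputRateArithmetic

open Literature.MathematicalPhysics.QuantumFieldTheory.Balaban1983to89
open Literature.MathematicalPhysics.QuantumFieldTheory.Balaban1983to89.T4OutputRate
open Literature.MathematicalPhysics.QuantumFieldTheory.Balaban1983to89.T4InputCauchyRateData
open Literature.MathematicalPhysics.QuantumFieldTheory.Balaban1983to89.T4InputCauchyRateSpecies

/-! ## §1 Leaf L10 (REACH): the scale `k₀` and the constant `B` exist iff the fed-back level is strictly below the reach -/

section Reach

/-- L10, existence of the reach scale: if the input-rate constant `D ≥ 0` decays at a rate `θ < 1` and the fed-back one-run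
level `h` is STRICTLY below the reach `ρ₀`, some scale `k₀` satisfies the near hypothesis `D·θ^{k₀} + h ≤ ρ₀`. [folklore] -/
theorem reach_scale_exists {D θ h ρ₀ : ℝ} (hD : 0 ≤ D) (hθ1 : θ < 1) (hreach : h < ρ₀) :
    ∃ k₀ : ℕ, D * θ ^ k₀ + h ≤ ρ₀ := by
  rcases hD.eq_or_lt with hD0 | hDpos
  · exact ⟨0, by rw [← hD0]; linarith⟩
  · obtain ⟨n, hn⟩ := exists_pow_lt_of_lt_one (div_pos (sub_pos.mpr hreach) hDpos) hθ1
    have h1 : θ ^ n * D < ρ₀ - h := (lt_div_iff₀ hDpos).mp hn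
    exact ⟨n, by linarith⟩

/-- L10 is monotone in the scale: any later `k₁ ≥ k₀` also works (`θ ≤ 1`). [folklore] -/
theorem reach_scale_mono {D θ h ρ₀ : ℝ} {k₀ k₁ : ℕ} (hD : 0 ≤ D) (hθ0 : 0 ≤ θ) (hθ1 : θ ≤ 1)
    (hnear : D * θ ^ k₀ + h ≤ ρ₀) (hk : k₀ ≤ k₁) : D * θ ^ k₁ + h ≤ ρ₀ := by
  linarith [mul_le_mul_of_nonneg_left (pow_le_pow_of_le_one hθ0 hθ1 hk) hD]

/-- L10, necessity: with a genuine input rate (`D > 0`, `θ > 0`) the near hypothesis forces `h < ρ₀` strictly. [folklore] -/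
theorem reach_necessary {D θ h ρ₀ : ℝ} {k₀ : ℕ} (hD : 0 < D) (hθ0 : 0 < θ) (hnear : D * θ ^ k₀ + h ≤ ρ₀) : h < ρ₀ := by
  linarith [mul_pos hD (pow_pos hθ0 k₀)]

/-- **L10 DECIDED**: for `D, θ > 0`, `θ < 1`, a reach scale exists iff `h < ρ₀` — the skeleton's sentence "satisfiable by a choice of
k₀ iff c(EA₀ + E₀)/(1 − ω) < ρ₀" in the kernel. [folklore] -/
theorem reach_scale_iff {D θ h ρ₀ : ℝ} (hD : 0 < D) (hθ0 : 0 < θ) (hθ1 : θ < 1) :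
    (∃ k₀ : ℕ, D * θ ^ k₀ + h ≤ ρ₀) ↔ h < ρ₀ :=
  ⟨fun ⟨_, hk⟩ => reach_necessary hD hθ0 hk, reach_scale_exists hD.le hθ1⟩

/-- **THE THREE L10 BINDERS AT ONCE**: from `0 ≤ D`, `0 < θ < 1` and the strict reach `c(EA₀ + E₀)/(1 − ω) < ρ₀`, a scale `k₀` and a
constant `B ≥ 0` with `hnear` and `hfirst` (the latter by `OutputRateResidual.first_scales_const`, `B = max 0 ((EA₀ + E₀)/θ^{k₀})`).
One `obtain ⟨k₀, B, hB, hnear, hfirst⟩` discharges the L10 binders of every END face of the route. [folklore] -/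
theorem reach_binders_exists {D θ c ω ρ₀ EA₀ E₀ : ℝ} (hD : 0 ≤ D) (hθ0 : 0 < θ) (hθ1 : θ < 1)
    (hreach : c * (EA₀ + E₀) / (1 - ω) < ρ₀) :
    ∃ k₀ : ℕ, ∃ B : ℝ, 0 ≤ B ∧ D * θ ^ k₀ + c * (EA₀ + E₀) / (1 - ω) ≤ ρ₀ ∧ ∀ k < k₀, EA₀ + E₀ ≤ B * θ ^ k := by
  obtain ⟨k₀, hk₀⟩ := reach_scale_exists hD hθ1 hreach
  exact ⟨k₀, max 0 ((EA₀ + E₀) / θ ^ k₀), le_max_left _ _, hk₀,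
    fun k hk => OutputRateResidual.first_scales_const hθ0 hθ1.le hk.le⟩

end Reach

/-! ## §2 Leaf L11 (SMALLNESS): the rate window -/

section Window

/-- **L11 DECIDED AS A WINDOW**: a target rate `θ′` with `θ ≤ θ′ < 1` past the threshold `s` (= `ω + Λ·c`) exists iff `θ < 1` and
`s < 1`; witness `max θ ((s + 1)/2)`.  (That the threshold is sharp at the typed interface is `T4InputCauchyRateSharp.sharp_ne5_iff`.)
[folklore] -/
theorem rate_window_iff {θ s : ℝ} : (∃ θ', θ ≤ θ' ∧ θ' < 1 ∧ s < θ') ↔ (θ < 1 ∧ s < 1) := by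
  constructor
  · rintro ⟨θ', h1, h2, h3⟩
    exact ⟨lt_of_le_of_lt h1 h2, h3.trans h2⟩
  · rintro ⟨hθ, hs⟩
    exact ⟨max θ ((s + 1) / 2), le_max_left _ _, max_lt hθ (by linarith), lt_max_of_lt_right (by linarith)⟩

end Window

/-! ## §3 The END faces with L10 discharged -/

section Faces

variable {C : Carriers} {Op Hist : Type*} [NormedAddCommGroup Op] [NormedSpace ℂ Op] [NormedAddCommGroup Hist]
  [NormedSpace ℂ Hist] (M : StepModel C Op Hist)

/-- **THE DATA END FACE WITH L10 DISCHARGED**: the hypotheses of `StepModel.ne5_at_of_stepModel_lip_nat` with the reach scale `k₀`,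
the first-scales constant `B` and the binders `hnear`, `hB`, `hfirst` REPLACED by `0 < θ < 1` and the strict reach
`c(EA₀ + E₀)/(1 − ω) < ρ₀`; NE5 at the prescribed `θ′` with SOME constant. [folklore] -/
theorem exists_ne5_at_of_stepModel_lip_nat_reach {EA : Functional C C.BgA} {EB : Functional C C.BgB} {W : Set (ℕ → ℝ)}
    {κ Λ EA₀ E₀ δ δ' θ θ' c ω ρ₀ : ℝ} (hrA : M.RepresentsA EA W) (hrB : M.RepresentsB EB W)
    (hbase : M.InBase EB W) (hlip : M.DataLipschitz W κ Λ ρ₀) (hdA : DecayBound EA W EA₀ κ)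
    (hdB : DecayBound EB W E₀ κ) (hop : M.OperatorRate W δ θ) (hins : M.InsertionRate W κ E₀ δ' θ)
    (hdamp : M.InsertionDampedNat W κ c ω) (hΛ : 0 ≤ Λ) (hδ : 0 ≤ δ + δ') (hθ0 : 0 < θ) (hθ1 : θ < 1)
    (hθθ' : θ ≤ θ') (hθ'1 : θ' ≤ 1) (hc : 0 ≤ c) (hω : 0 < ω) (hreach : c * (EA₀ + E₀) / (1 - ω) < ρ₀)
    (hsmall : ω + Λ * c < θ') : ∃ C₅, NE5 EA EB W κ θ' C₅ := by
  obtain ⟨k₀, B, hB, hnear, hfirst⟩ := reach_binders_exists hδ hθ0 hθ1 hreach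
  exact ⟨_, M.ne5_at_of_stepModel_lip_nat hrA hrB hbase hlip hdA hdB hop hins hdamp hΛ hδ hθ0.le hθθ' hθ'1 hc hω
    hnear hB hfirst hsmall⟩

/-- **THE SPECIES END FACE WITH L10 DISCHARGED** (`T4InputCauchyRateSpecies.ne5_at_of_stepModel_lip₂_nat`: two moduli, only
`Λhist` in the smallness). [folklore] -/
theorem exists_ne5_at_of_stepModel_lip₂_nat_reach {EA : Functional C C.BgA} {EB : Functional C C.BgB} {W : Set (ℕ → ℝ)}
    {κ Λop Λhist EA₀ E₀ δ δ' θ θ' c ω ρ₀ : ℝ} (hrA : M.RepresentsA EA W) (hrB : M.RepresentsB EB W)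
    (hbase : M.InBase EB W) (hlip : DataLipschitz₂ M W κ Λop Λhist ρ₀) (hdA : DecayBound EA W EA₀ κ)
    (hdB : DecayBound EB W E₀ κ) (hop : M.OperatorRate W δ θ) (hins : M.InsertionRate W κ E₀ δ' θ)
    (hdamp : M.InsertionDampedNat W κ c ω) (hΛop : 0 ≤ Λop) (hΛhist : 0 ≤ Λhist) (hδ : 0 ≤ δ) (hδ' : 0 ≤ δ')
    (hθ0 : 0 < θ) (hθ1 : θ < 1) (hθθ' : θ ≤ θ') (hθ'1 : θ' ≤ 1) (hc : 0 ≤ c) (hω : 0 < ω)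
    (hreach : c * (EA₀ + E₀) / (1 - ω) < ρ₀) (hsmall : ω + Λhist * c < θ') : ∃ C₅, NE5 EA EB W κ θ' C₅ := by
  obtain ⟨k₀, B, hB, hnear, hfirst⟩ := reach_binders_exists (add_nonneg hδ hδ') hθ0 hθ1 hreach
  exact ⟨_, ne5_at_of_stepModel_lip₂_nat M hrA hrB hbase hlip hdA hdB hop hins hdamp hΛop hΛhist hδ hδ' hθ0.le hθθ'
    hθ'1 hc hω hnear hB hfirst hsmall⟩

/-- **BOTH ARITHMETIC LEAVES DISCHARGED TO ROOM**: at an input rate `0 < θ < 1`, the strict reach `c(EA₀ + E₀)/(1 − ω) < ρ₀` (L10)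
and the room `ω + Λ·c < 1` (L11) yield SOME rate `θ′ < 1` and constant with NE5 (Data END face). [folklore] -/
theorem exists_rate_ne5_of_stepModel_lip_nat_reach {EA : Functional C C.BgA} {EB : Functional C C.BgB} {W : Set (ℕ → ℝ)}
    {κ Λ EA₀ E₀ δ δ' θ c ω ρ₀ : ℝ} (hrA : M.RepresentsA EA W) (hrB : M.RepresentsB EB W)
    (hbase : M.InBase EB W) (hlip : M.DataLipschitz W κ Λ ρ₀) (hdA : DecayBound EA W EA₀ κ)
    (hdB : DecayBound EB W E₀ κ) (hop : M.OperatorRate W δ θ) (hins : M.InsertionRate W κ E₀ δ' θ)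
    (hdamp : M.InsertionDampedNat W κ c ω) (hΛ : 0 ≤ Λ) (hδ : 0 ≤ δ + δ') (hθ0 : 0 < θ) (hθ1 : θ < 1)
    (hc : 0 ≤ c) (hω : 0 < ω) (hreach : c * (EA₀ + E₀) / (1 - ω) < ρ₀) (hroom : ω + Λ * c < 1) :
    ∃ θ', θ' < 1 ∧ ∃ C₅, NE5 EA EB W κ θ' C₅ := by
  obtain ⟨θ', hθθ', hθ'1, hsmall⟩ := rate_window_iff.mpr ⟨hθ1, hroom⟩
  exact ⟨θ', hθ'1, exists_ne5_at_of_stepModel_lip_nat_reach M hrA hrB hbase hlip hdA hdB hop hins hdamp hΛ hδ hθ0 hθ1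
    hθθ' hθ'1.le hc hω hreach hsmall⟩

end Faces

/-! ## §4 The exact admissible region of the census currencies (g′), (g″), NUMBERS (d) -/

section Region

/-- The smallness value is monotone in the reach (`x ≥ 0`, `ρ₀ ≤ ρ₁ < 1`). [folklore] -/
theorem gain_div_mono {x ρ₀ ρ₁ : ℝ} (hx : 0 ≤ x) (h : ρ₀ ≤ ρ₁) (hρ₁ : ρ₁ < 1) : x / (1 - ρ₀) ≤ x / (1 - ρ₁) :=
  div_le_div_of_nonneg_left hx (by linarith) (by linarith)

/-- Algebra of the minimal reach: `g·y/(1 − 2y/(1 − ω)) = g·y·(1 − ω)/(1 − ω − 2y)` (`ω ≠ 1`). [folklore] -/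
theorem gain_at_min_reach {ω g y : ℝ} (hω1 : ω ≠ 1) :
    g * y / (1 - 2 * y / (1 - ω)) = g * y * (1 - ω) / (1 - ω - 2 * y) := by
  have h1ω : (1 : ℝ) - ω ≠ 0 := sub_ne_zero.mpr (Ne.symm hω1)
  rw [one_sub_div h1ω, div_div_eq_mul_div]

/-- **THE CENSUS REGION AT A TARGET**: with age damping `ω < 1`, gain coefficient `g ≥ 0` and size `y ≥ 0` (reach `2y/(1 − ω)`,
smallness value `ω + g·y/(1 − ρ₀)` at reach `ρ₀`), SOME admissible reach `ρ₀ ∈ [2y/(1 − ω), 1)` puts the smallness value below the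
target `t` iff `2y < 1 − ω` and the value AT THE MINIMAL REACH, `s⋆ = ω + g·y·(1 − ω)/(1 − ω − 2y)`, is below `t` — the minimal
reach is optimal.  Currencies: (g′) `g = γ₀`, `y = ν/d`; (g″) `g = γ₀`, `y = λν/(λ − μ)`; NUMBERS (d) `g = λ`, `y = ν/(λ − 1)`;
`t = θ′ = L^{−a}`. [folklore] -/
theorem reach_smallness_at_iff {ω g y t : ℝ} (hω1 : ω < 1) (hg : 0 ≤ g) (hy : 0 ≤ y) :
    (∃ ρ₀, 2 * y / (1 - ω) ≤ ρ₀ ∧ ρ₀ < 1 ∧ ω + g * y / (1 - ρ₀) < t) ↔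
      (2 * y < 1 - ω ∧ ω + g * y * (1 - ω) / (1 - ω - 2 * y) < t) := by
  have h1ω : 0 < 1 - ω := sub_pos.mpr hω1
  have hgy : 0 ≤ g * y := mul_nonneg hg hy
  rw [← gain_at_min_reach hω1.ne]
  constructor
  · rintro ⟨ρ₀, hr, hρ₀, hs⟩
    have h2y : 2 * y < 1 - ω := (div_lt_one h1ω).mp (lt_of_le_of_lt hr hρ₀)
    have hmono := gain_div_mono hgy hr hρ₀
    exact ⟨h2y, by linarith⟩
  · rintro ⟨h2y, hs⟩
    exact ⟨2 * y / (1 - ω), le_rfl, (div_lt_one h1ω).mpr h2y, hs⟩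

/-- **THE CENSUS REGION (existence of SOME rate)**: with `t = 1` the condition is the single strict inequality `(g + 2)·y < 1 − ω`.
Record §25.3: "admissible iff x = ν/d < (1 − ω)/(3γ₀) = 5/16" (g = γ₀ = 1, ω = 1/16); §27.3: "admissible iff ν_eff < 5/16"; Data
leaf NUMBERS (d) at the printed ceiling ν = ½ (g = λ, y = ½/(λ − 1)): `λ > (4 − 2ω)/(1 − 2ω)`. [folklore] -/
theorem reach_smallness_iff {ω g y : ℝ} (hω1 : ω < 1) (hg : 0 ≤ g) (hy : 0 ≤ y) :
    (∃ ρ₀, 2 * y / (1 - ω) ≤ ρ₀ ∧ ρ₀ < 1 ∧ ω + g * y / (1 - ρ₀) < 1) ↔ (g + 2) * y < 1 - ω := by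
  rw [reach_smallness_at_iff hω1 hg hy]
  have h1ω : 0 < 1 - ω := sub_pos.mpr hω1
  have hgy : 0 ≤ g * y := mul_nonneg hg hy
  have hexp : (g + 2) * y = g * y + 2 * y := by ring
  constructor
  · rintro ⟨h2y, hs⟩
    have hpos : 0 < 1 - ω - 2 * y := by linarith
    have h1 : g * y * (1 - ω) / (1 - ω - 2 * y) < 1 - ω := by linarith
    have h2 : g * y * (1 - ω) < (1 - ω - 2 * y) * (1 - ω) := by
      have := (div_lt_iff₀ hpos).mp h1
      linarith
    have h3 : g * y < 1 - ω - 2 * y := lt_of_mul_lt_mul_right h2 h1ω.le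
    linarith
  · intro h
    have h2y : 2 * y < 1 - ω := by nlinarith
    have hpos : 0 < 1 - ω - 2 * y := by linarith
    refine ⟨h2y, ?_⟩
    have h3 : g * y < 1 - ω - 2 * y := by linarith
    have h2 : g * y * (1 - ω) < (1 - ω - 2 * y) * (1 - ω) := mul_lt_mul_of_pos_right h3 h1ω
    have h1 : g * y * (1 - ω) / (1 - ω - 2 * y) < 1 - ω := by
      rw [div_lt_iff₀ hpos]
      linarith
    linarith

/-- (g′)/(g″) threshold at γ₀ = 1: `3y < 1 − ω`, i.e. `y < 5/16` at ω = 1/16 (record §25.3/§27.3) and `y < 4/13` at ω = 1/13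
(L = 13, the least side length of the printed form). [folklore] -/
example : ((1 : ℝ) - 1 / 16) / (1 + 2) = 5 / 16 ∧ ((1 : ℝ) - 1 / 13) / (1 + 2) = 4 / 13 := by norm_num

/-- NUMBERS (d) threshold at the printed ceiling ν = ½: `(λ + 2)·(½/(λ − 1)) < 1 − ω ↔ λ > (4 − 2ω)/(1 − 2ω)` for `λ > 1`,
`ω < ½`; the bound is 31/7 at ω = 1/16 ("λ ≳ 5" of the Data leaf's docstring NUMBERS (d)) and 50/11 at ω = 1/13. [folklore] -/
theorem lambda_threshold_iff {ω lam : ℝ} (hω : ω < 1 / 2) (hlam : 1 < lam) :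
    (lam + 2) * ((1 / 2) / (lam - 1)) < 1 - ω ↔ (4 - 2 * ω) / (1 - 2 * ω) < lam := by
  have h1 : 0 < lam - 1 := sub_pos.mpr hlam
  have h2 : 0 < 1 - 2 * ω := by linarith
  rw [show (lam + 2) * ((1 / 2) / (lam - 1)) = ((lam + 2) / 2) / (lam - 1) by ring, div_lt_iff₀ h1,
    div_lt_iff₀ (by norm_num : (0 : ℝ) < 2), div_lt_iff₀ h2]
  constructor <;> intro h <;> nlinarith

/-- The two numeric thresholds of `lambda_threshold_iff`. [folklore] -/
example : ((4 : ℝ) - 2 * (1 / 16)) / (1 - 2 * (1 / 16)) = 31 / 7 ∧ ((4 : ℝ) - 2 * (1 / 13)) / (1 - 2 * (1 / 13)) = 50 / 11 := by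
  norm_num

end Region

/-! ## §5 Certificate format for the census exponent column, and the illustrative rows re-certified -/

section Exponent

set_option exponentiation.threshold 1100

/-- **EXPONENT CERTIFICATE (sufficient side)**: for naturals with `q, L, n > 0`, the integer inequality `p^n·L^m < q^n` certifies
`p/q < L^{−m/n}` over ℝ — i.e. the smallness value `s = p/q` admits the target rate `θ′ = L^{−a}` with `a = m/n`. [folklore] -/
theorem ratio_lt_rpow_neg {p q L m n : ℕ} (hq : 0 < q) (hL : 0 < L) (hn : 0 < n) (h : p ^ n * L ^ m < q ^ n) :
    (p : ℝ) / q < (L : ℝ) ^ (-((m : ℝ) / n)) := by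
  have hqR : (0 : ℝ) < q := by exact_mod_cast hq
  have hLR : (0 : ℝ) < L := by exact_mod_cast hL
  have hnR : (0 : ℝ) < n := by exact_mod_cast hn
  have hs0 : (0 : ℝ) ≤ p / q := div_nonneg (Nat.cast_nonneg p) hqR.le
  have hcast : (p : ℝ) ^ n * (L : ℝ) ^ m < (q : ℝ) ^ n := by exact_mod_cast h
  have h1 : ((p : ℝ) / q) ^ n * (L : ℝ) ^ m < 1 := by
    rw [div_pow, div_mul_eq_mul_div, div_lt_one (pow_pos hqR n)]
    exact hcast
  have h2 : ((p : ℝ) / q) ^ n < 1 / (L : ℝ) ^ m := by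
    rw [lt_div_iff₀ (pow_pos hLR m)]
    exact h1
  have h3 : (p : ℝ) / q < (1 / (L : ℝ) ^ m) ^ ((n : ℝ)⁻¹) := by
    have := Real.rpow_lt_rpow (pow_nonneg hs0 n) h2 (inv_pos.mpr hnR)
    rwa [Real.pow_rpow_inv_natCast hs0 hn.ne'] at this
  have h4 : (1 / (L : ℝ) ^ m) ^ ((n : ℝ)⁻¹) = (L : ℝ) ^ (-((m : ℝ) / n)) := by
    rw [one_div, Real.inv_rpow (pow_nonneg hLR.le m), ← Real.rpow_natCast, ← Real.rpow_mul hLR.le,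
      Real.rpow_neg hLR.le, div_eq_mul_inv]
  rwa [h4] at h3

/-- **EXPONENT CERTIFICATE (failing side)**: `q^n < p^n·L^m` certifies `L^{−m/n} < p/q` — the target rate `L^{−m/n}` is NOT past the
threshold `p/q`. [folklore] -/
theorem rpow_neg_lt_ratio {p q L m n : ℕ} (hq : 0 < q) (hL : 0 < L) (hn : 0 < n) (h : q ^ n < p ^ n * L ^ m) :
    (L : ℝ) ^ (-((m : ℝ) / n)) < (p : ℝ) / q := by
  have hqR : (0 : ℝ) < q := by exact_mod_cast hq
  have hLR : (0 : ℝ) < L := by exact_mod_cast hL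
  have hnR : (0 : ℝ) < n := by exact_mod_cast hn
  have hs0 : (0 : ℝ) ≤ p / q := div_nonneg (Nat.cast_nonneg p) hqR.le
  have hcast : (q : ℝ) ^ n < (p : ℝ) ^ n * (L : ℝ) ^ m := by exact_mod_cast h
  have h1 : 1 < ((p : ℝ) / q) ^ n * (L : ℝ) ^ m := by
    rw [div_pow, div_mul_eq_mul_div, one_lt_div (pow_pos hqR n)]
    exact hcast
  have h2 : 1 / (L : ℝ) ^ m < ((p : ℝ) / q) ^ n := by
    rw [div_lt_iff₀ (pow_pos hLR m)]
    exact h1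
  have h3 : (1 / (L : ℝ) ^ m) ^ ((n : ℝ)⁻¹) < (p : ℝ) / q := by
    have := Real.rpow_lt_rpow (by positivity) h2 (inv_pos.mpr hnR)
    rwa [Real.pow_rpow_inv_natCast hs0 hn.ne'] at this
  have h4 : (1 / (L : ℝ) ^ m) ^ ((n : ℝ)⁻¹) = (L : ℝ) ^ (-((m : ℝ) / n)) := by
    rw [one_div, Real.inv_rpow (pow_nonneg hLR.le m), ← Real.rpow_natCast, ← Real.rpow_mul hLR.le,
      Real.rpow_neg hLR.le, div_eq_mul_inv]
  rwa [h4] at h3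

/-! ### The lineage's illustrative rows at L = 16, ω = 1/16, γ₀ = 1 (record §25.3 (g′), §27.3 (g″), §36.6 (h); Data leaf NUMBERS
(d)).  Each `example` certifies the exact reach / smallness value and the exponent digit `a` (θ′ = 16^{−a} satisfies S at the
row's smallness value); engines 1–2 of the census sheet print the same integers.  ILLUSTRATIVE: no letter of Bałaban's is
given a value by these rows (ν ∝ ε₁ carries an unprinted O(1); d, μ, λ, N̄ are route parameters). -/

/-- (g″) canonical row λ = 2, μ = 1, ν = 1/100 (y = 1/50): reach 16/375, gain 15/718, smallness 479/5744; a = 0.895 admissible.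
[folklore] -/
example : 2 * (1 / 50 : ℝ) / (1 - 1 / 16) = 16 / 375 ∧ (1 / 50 : ℝ) / (1 - 16 / 375) = 15 / 718 ∧
    (1 : ℝ) / 16 + 15 / 718 = 479 / 5744 ∧ (479 : ℝ) / 5744 < (16 : ℝ) ^ (-((895 : ℝ) / 1000)) := by
  refine ⟨by norm_num, by norm_num, by norm_num, ?_⟩
  exact_mod_cast ratio_lt_rpow_neg (p := 479) (q := 5744) (L := 16) (m := 895) (n := 1000) (by norm_num) (by norm_num)
    (by norm_num) (by decide)

/-- (g′) μ = ν = 1/10, d = 9/10 (y = 1/9): reach 32/135, smallness 343/1648; a = 0.566 admissible. [folklore] -/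
example : 2 * (1 / 9 : ℝ) / (1 - 1 / 16) = 32 / 135 ∧ (1 : ℝ) / 16 + (1 / 9) / (1 - 32 / 135) = 343 / 1648 ∧
    (343 : ℝ) / 1648 < (16 : ℝ) ^ (-((566 : ℝ) / 1000)) := by
  refine ⟨by norm_num, by norm_num, ?_⟩
  exact_mod_cast ratio_lt_rpow_neg (p := 343) (q := 1648) (L := 16) (m := 566) (n := 1000) (by norm_num) (by norm_num)
    (by norm_num) (by decide)

/-- (h) secant face N̄ν = 1/100: smallness 33/400; a = 0.899 admissible. [folklore] -/
example : (1 : ℝ) / 16 + 2 * (1 / 100) = 33 / 400 ∧ (33 : ℝ) / 400 < (16 : ℝ) ^ (-((899 : ℝ) / 1000)) := by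
  refine ⟨by norm_num, ?_⟩
  exact_mod_cast ratio_lt_rpow_neg (p := 33) (q := 400) (L := 16) (m := 899) (n := 1000) (by norm_num) (by norm_num)
    (by norm_num) (by decide)

/-- NUMBERS (d) at the printed ceiling ν = ½, λ = 11 (g = 11, y = 1/20): history part of the reach 8/75 ("0.107"), K′ = 165/134
("≈ 1.23"), smallness 727/1072; a = 0.140 admissible ("≈ 0.14"). [folklore] -/
example : 2 * (1 / 20 : ℝ) / (1 - 1 / 16) = 8 / 75 ∧ (11 : ℝ) / ((11 - 1) * (1 - 8 / 75)) = 165 / 134 ∧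
    (1 : ℝ) / 16 + 11 * (1 / 20) / (1 - 8 / 75) = 727 / 1072 ∧ (727 : ℝ) / 1072 < (16 : ℝ) ^ (-((140 : ℝ) / 1000)) := by
  refine ⟨by norm_num, by norm_num, by norm_num, ?_⟩
  exact_mod_cast ratio_lt_rpow_neg (p := 727) (q := 1072) (L := 16) (m := 140) (n := 1000) (by norm_num) (by norm_num)
    (by norm_num) (by decide)

/-- NUMBERS (c)/(d), the K → 1 limit at ν = ½: smallness 9/16; a = 0.207 admissible ("≈ 0.21"; "≈ 0.2" in (c)) and a = 0.208 is
not. [folklore] -/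
example : (9 : ℝ) / 16 < (16 : ℝ) ^ (-((207 : ℝ) / 1000)) ∧ (16 : ℝ) ^ (-((208 : ℝ) / 1000)) < (9 : ℝ) / 16 := by
  constructor
  · exact_mod_cast ratio_lt_rpow_neg (p := 9) (q := 16) (L := 16) (m := 207) (n := 1000) (by norm_num) (by norm_num)
      (by norm_num) (by decide)
  · exact_mod_cast rpow_neg_lt_ratio (p := 9) (q := 16) (L := 16) (m := 208) (n := 1000) (by norm_num) (by norm_num)
      (by norm_num) (by decide)

/-! ### The three rows whose nearest-rounded exponent digit exceeds the supremum (INFO: read "a <" as the rounded supremum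
`log_L(1/s)`, not as an admissible value; no census value changes) -/

/-- (g′) μ = ν = 1/100, d = 99/100 (y = 1/99): smallness 1693/23248; a = 0.944 admissible, the printed digit 0.945 is NOT.
[folklore] -/
example : (1 : ℝ) / 16 + (1 / 99) / (1 - 2 * (1 / 99) / (1 - 1 / 16)) = 1693 / 23248 ∧
    (1693 : ℝ) / 23248 < (16 : ℝ) ^ (-((944 : ℝ) / 1000)) ∧ (16 : ℝ) ^ (-((945 : ℝ) / 1000)) < (1693 : ℝ) / 23248 := by
  refine ⟨by norm_num, ?_, ?_⟩
  · exact_mod_cast ratio_lt_rpow_neg (p := 1693) (q := 23248) (L := 16) (m := 944) (n := 1000) (by norm_num) (by norm_num)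
      (by norm_num) (by decide)
  · exact_mod_cast rpow_neg_lt_ratio (p := 1693) (q := 23248) (L := 16) (m := 945) (n := 1000) (by norm_num) (by norm_num)
      (by norm_num) (by decide)

/-- (g′) μ = ½ + ν, ν = 1/1000, d = 499/1000 (y = 1/499): smallness 7693/119248; a = 0.988 admissible, 0.989 is NOT. [folklore] -/
example : (1 : ℝ) / 16 + (1 / 499) / (1 - 2 * (1 / 499) / (1 - 1 / 16)) = 7693 / 119248 ∧
    (7693 : ℝ) / 119248 < (16 : ℝ) ^ (-((988 : ℝ) / 1000)) ∧ (16 : ℝ) ^ (-((989 : ℝ) / 1000)) < (7693 : ℝ) / 119248 := by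
  refine ⟨by norm_num, ?_, ?_⟩
  · exact_mod_cast ratio_lt_rpow_neg (p := 7693) (q := 119248) (L := 16) (m := 988) (n := 1000) (by norm_num)
      (by norm_num) (by norm_num) (by decide)
  · exact_mod_cast rpow_neg_lt_ratio (p := 7693) (q := 119248) (L := 16) (m := 989) (n := 1000) (by norm_num)
      (by norm_num) (by norm_num) (by decide)

/-- (g′) d = 1/10, ν = 1/100 (y = 1/10): reach 16/75, smallness 179/944; a = 0.599 admissible, 0.600 is NOT. [folklore] -/
example : 2 * (1 / 10 : ℝ) / (1 - 1 / 16) = 16 / 75 ∧ (1 : ℝ) / 16 + (1 / 10) / (1 - 16 / 75) = 179 / 944 ∧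
    (179 : ℝ) / 944 < (16 : ℝ) ^ (-((599 : ℝ) / 1000)) ∧ (16 : ℝ) ^ (-((600 : ℝ) / 1000)) < (179 : ℝ) / 944 := by
  refine ⟨by norm_num, by norm_num, ?_, ?_⟩
  · exact_mod_cast ratio_lt_rpow_neg (p := 179) (q := 944) (L := 16) (m := 599) (n := 1000) (by norm_num) (by norm_num)
      (by norm_num) (by decide)
  · exact_mod_cast rpow_neg_lt_ratio (p := 179) (q := 944) (L := 16) (m := 600) (n := 1000) (by norm_num) (by norm_num)
      (by norm_num) (by decide)

/-! ### L = 13 twins (the least side length of the printed form «L is an odd, positive integer > 11», [Balaban1987RG1] p. 251;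
ω = 1/13): the canonical (g″) row -/

/-- (g″) λ = 2, μ = 1, ν = 1/100 at L = 13: reach 13/300, smallness 365/3731; a = 0.906 admissible (0.895 at L = 16). [folklore] -/
example : 2 * (1 / 50 : ℝ) / (1 - 1 / 13) = 13 / 300 ∧ (1 : ℝ) / 13 + (1 / 50) / (1 - 13 / 300) = 365 / 3731 ∧
    (365 : ℝ) / 3731 < (13 : ℝ) ^ (-((906 : ℝ) / 1000)) := by
  refine ⟨by norm_num, by norm_num, ?_⟩
  exact_mod_cast ratio_lt_rpow_neg (p := 365) (q := 3731) (L := 13) (m := 906) (n := 1000) (by norm_num) (by norm_num)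
    (by norm_num) (by decide)

end Exponent

end Summit.QuantumFields.BalabanUV.T4Continuum.OutputRateArithmetic

end
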